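import Summits.AtomisticToContinuum.HydrodynamicLimit.Theses.ImplosionDichotomy
import Summits.AtomisticToContinuum.HydrodynamicLimit.Theorems.DenseExcursion.Negative.AtTimeZero
import Literature.Analysis.FluidPDE.HardSphereAlexander
import Literature.Analysis.FunctionSpaces.TorusCalculusProofs
import Literature.Analysis.FunctionSpaces.TorusSpaceTime

/-!
# No dense excursion on a bounded compression budget: an EOS-free maximum principle

Negative knowledge for the crux `ImplosionDichotomy.DenseExcursion` (stmt-AtomisticToContinuum-12586), from the
standing disprover's `Cruxes/DenseExcursion/Disproof.lean` §11 (gen 3). The second EOS-free a-priori estimate along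
classical hard-sphere-Euler solutions (after mass conservation, `Negative/Everywhere.lean`): a MAXIMUM PRINCIPLE FOR
THE CONTINUITY EQUATION — if `-K ≤ div u` on `[0, t] × 𝕋³` then `ρ(t, x) ≤ max ρ(0, ·) · e^{K t}`, for every `σ` and
every pressure law (only the mass equation, joint smoothness and `ρ > 0` are used: first-touch argument on
`ρ e^{-Lt}`, `L > K`, Fermat at a spatial maximum, `L ↓ K`). With the pinned admissible data of `Negative/AtTimeZero.lean`
(`ρ(0) = rhoLim < (2e+1)M` uniformly in `σ`) the packing of an admissible solution is `< (2e+1) M σ³ e^{K t}`.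
Hence two natural strengthenings of the crux are FALSE, unconditionally:
`DenseExcursionBoundedCompression` (a `σ`-uniform bound `-K ≤ div u` up to the excursion time `t ≤ T₀`) and
`DenseExcursionLipschitzVelocity` (a `σ`-uniform velocity-gradient bound `‖Du‖ ≤ M`, the shape of the continuation
hypothesis of the line's well-posedness stub). Every witness family of the crux must have
`sup_{s ≤ t} ‖(div u_σ(s))₋‖_∞ · t ≥ log(η/((2e+1)Mσ³)) = 3 log σ⁻¹ + O(1)`: the velocity gradient blows up, from the
FIXED datum `u₀`, before the packing is reached (consistent with self-similar implosion, `div u ∼ -(T*-t)⁻¹`).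
refuter-cdisprove-stmt-AtomisticToContinuum-12586-g3-0.
-/

noncomputable section

namespace Summit.AtomisticToContinuum.HydrodynamicLimit.Theorems

open MeasureTheory Filter Set Topology
open scoped ENNReal InnerProductSpace
open Literature.MathematicalPhysics.KineticTheory Literature.Analysis.FluidPDE
open Literature.Analysis.FunctionSpaces

/-- The crux `DenseExcursion` strengthened by a `σ`-UNIFORM COMPRESSION BUDGET: the witnesses reach packing `η` at a
time `t ≤ T₀` with `-K ≤ div u` on `[0, t] × 𝕋³`, `K, T₀` independent of `σ` (all else verbatim). -/
def DenseExcursionBoundedCompression : Prop :=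
  ∃ K T₀ : ℝ, ∃ η : ℝ, 0 < η ∧ ∃ (a₀ θ₀ : Literature.MathematicalPhysics.KineticTheory.T3 → ℝ) (u₀ : Literature.MathematicalPhysics.KineticTheory.T3 → Literature.MathematicalPhysics.KineticTheory.V3), Continuous a₀ ∧ Continuous θ₀ ∧ Continuous u₀ ∧ (∀ x, 0 < a₀ x) ∧ (∀ x, 0 < θ₀ x) ∧ ∀ σ₀ : ℝ, 0 < σ₀ → ∃ σ : ℝ, 0 < σ ∧ σ < σ₀ ∧ ∃ (T : ℝ) (ρ θ : ℝ → Literature.MathematicalPhysics.KineticTheory.T3 → ℝ) (u : ℝ → Literature.MathematicalPhysics.KineticTheory.T3 → Literature.MathematicalPhysics.KineticTheory.V3), Literature.MathematicalPhysics.KineticTheory.IsHardSphereEulerSolution σ T ρ u θ ∧ (∀ Φ : (N : ℕ) → Literature.Analysis.FluidPDE.HardSphereFlow (Literature.Analysis.FluidPDE.Torus.geometry (Fin 3)) (Literature.MathematicalPhysics.KineticTheory.hsDiameter σ N) (N + 1), Literature.MathematicalPhysics.KineticTheory.TendstoHydroFieldsAt (fun N => Literature.MathematicalPhysics.KineticTheory.localGibbsLaw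 σ a₀ u₀ θ₀ N (Φ N)) Φ ρ u θ 0) ∧ ∃ t ∈ Set.Ico 0 T, t ≤ T₀ ∧ (∀ s ∈ Set.Icc 0 t, ∀ x, -K ≤ Literature.Analysis.FunctionSpaces.Torus.divergence (u s) x) ∧ ∃ x, η ≤ ρ t x * σ ^ 3

/-- The crux `DenseExcursion` strengthened by a `σ`-UNIFORM VELOCITY-GRADIENT BOUND up to the excursion time:
`‖Du(s, x)‖ ≤ M` on `[0, t] × 𝕋³`, `t ≤ T₀`, `M, T₀` independent of `σ` (all else verbatim). -/
def DenseExcursionLipschitzVelocity : Prop :=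
  ∃ M T₀ : ℝ, ∃ η : ℝ, 0 < η ∧ ∃ (a₀ θ₀ : Literature.MathematicalPhysics.KineticTheory.T3 → ℝ) (u₀ : Literature.MathematicalPhysics.KineticTheory.T3 → Literature.MathematicalPhysics.KineticTheory.V3), Continuous a₀ ∧ Continuous θ₀ ∧ Continuous u₀ ∧ (∀ x, 0 < a₀ x) ∧ (∀ x, 0 < θ₀ x) ∧ ∀ σ₀ : ℝ, 0 < σ₀ → ∃ σ : ℝ, 0 < σ ∧ σ < σ₀ ∧ ∃ (T : ℝ) (ρ θ : ℝ → Literature.MathematicalPhysics.KineticTheory.T3 → ℝ) (u : ℝ → Literature.MathematicalPhysics.KineticTheory.T3 → Literature.MathematicalPhysics.KineticTheory.V3), Literature.MathematicalPhysics.KineticTheory.IsHardSphereEulerSolution σ T ρ u θ ∧ (∀ Φ : (N : ℕ) → Literature.Analysis.FluidPDE.HardSphereFlow (Literature.Analysis.FluidPDE.Torus.geometry (Fin 3)) (Literature.MathematicalPhysics.KineticTheory.hsDiameter σ N) (N + 1), Literature.MathematicalPhysics.KineticTheory.TendstoHydroFieldsAt (fun N => Literature.MathematicalPhysics.KineticTheory.localGibbsLaw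 σ a₀ u₀ θ₀ N (Φ N)) Φ ρ u θ 0) ∧ ∃ t ∈ Set.Ico 0 T, t ≤ T₀ ∧ (∀ s ∈ Set.Icc 0 t, ∀ x, ‖Literature.Analysis.FunctionSpaces.Torus.fderiv (u s) x‖ ≤ M) ∧ ∃ x, η ≤ ρ t x * σ ^ 3

namespace DenseExcursionCompressionBudget

/-- **Fermat on the torus**: at a spatial maximum point every partial derivative vanishes (no differentiability
needed — the `deriv` junk value is `0` too). [folklore] -/
theorem partialDeriv_eq_zero_of_isMaxOn {f : T3 → ℝ} {x : T3} (hx : IsMaxOn f univ x) (i : Fin 3) :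
    Torus.partialDeriv i f x = 0 := by
  unfold Torus.partialDeriv Torus.lineDeriv
  apply IsLocalMax.deriv_eq_zero
  refine Filter.Eventually.of_forall fun s => ?_
  have h := hx (mem_univ (x + Torus.proj (s • EuclideanSpace.single i (1 : ℝ))))
  simpa using h

/-- Leibniz at a maximum point: `div (f v)(x) = f(x) · div v(x)` when `x` is a spatial maximum point of `f`. [folklore] -/
theorem divergence_smul_of_isMaxOn {f : T3 → ℝ} {v : T3 → V3} (hf : Torus.IsSmooth f)
    (hv : Torus.IsSmooth v) {x : T3} (hx : IsMaxOn f univ x) :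
    Torus.divergence (fun y => f y • v y) x = f x * Torus.divergence v x := by
  unfold Torus.divergence
  have h1 : Torus.IsContDiff 1 f := hf.isContDiff (by simp)
  have hsum : ∀ i : Fin 3, Torus.partialDeriv i (fun y => (f y • v y) i) x =
      f x * Torus.partialDeriv i (fun y => v y i) x := by
    intro i
    have h2 : Torus.IsContDiff 1 (fun y => v y i) := (hv.apply i).isContDiff (by simp)
    have e : (fun y => (f y • v y) i) = fun y => f y * v y i := by
      funext y; simp [PiLp.smul_apply]
    rw [e, Torus.partialDeriv_mul h1 h2 i x, partialDeriv_eq_zero_of_isMaxOn hx i]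
    ring
  rw [Finset.mul_sum]
  exact Finset.sum_congr rfl fun i _ => hsum i

/-- A maximum from the left forces a non-negative derivative. [folklore] -/
theorem deriv_nonneg_of_left_max {φ : ℝ → ℝ} {φ' t : ℝ} (hφ : HasDerivAt φ φ' t)
    (hmax : ∀ᶠ s in 𝓝[<] t, φ s ≤ φ t) : 0 ≤ φ' := by
  have hslope : Tendsto (slope φ t) (𝓝[<] t) (𝓝 φ') :=
    (hasDerivAt_iff_tendsto_slope_left_right.1 hφ).1
  refine ge_of_tendsto hslope ?_
  filter_upwards [self_mem_nhdsWithin, hmax] with s hs hφs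
  rw [slope_def_field]
  have h1 : φ s - φ t ≤ 0 := sub_nonpos.2 hφs
  have h2 : s - t < 0 := sub_neg.2 hs
  exact div_nonneg_of_nonpos h1 h2.le

/-- **MAXIMUM PRINCIPLE FOR THE CONTINUITY EQUATION (EOS-free, every `σ`).** Along any classical hard-sphere-Euler
solution, if `-K ≤ div u` on `[0, t₁] × 𝕋³` then `ρ(t₁, x) ≤ ρ(0, y) e^{K t₁}` for the initial maximum point `y`.
[folklore] -/
theorem density_le_max_mul_exp {σ T : ℝ} {ρ θ : ℝ → T3 → ℝ} {u : ℝ → T3 → V3}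
    (hE : IsHardSphereEulerSolution σ T ρ u θ) {t₁ : ℝ} (ht₁ : t₁ ∈ Ico 0 T) {K : ℝ}
    (hK : ∀ s ∈ Icc 0 t₁, ∀ x, -K ≤ Torus.divergence (u s) x) :
    ∃ y, ∀ x, ρ t₁ x ≤ ρ 0 y * Real.exp (K * t₁) := by
  have hT : 0 < T := ht₁.1.trans_lt ht₁.2
  have h0 : (0 : ℝ) ∈ Ico 0 T := ⟨le_rfl, hT⟩
  have hc0 : Continuous (ρ 0) := (hE.smooth_density.isSmooth_slice h0).continuous
  obtain ⟨y, -, hy⟩ := isCompact_univ.exists_isMaxOn univ_nonempty hc0.continuousOn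
  refine ⟨y, ?_⟩
  set M₀ := ρ 0 y with hM₀
  have hM₀pos : 0 < M₀ := hE.density_pos 0 h0 y
  have hyle : ∀ x, ρ 0 x ≤ M₀ := fun x => hy (mem_univ x)
  suffices hL : ∀ L, K < L → ∀ t ∈ Icc 0 t₁, ∀ x, ρ t x ≤ M₀ * Real.exp (L * t) by
    intro x
    have hcont : Continuous fun L : ℝ => M₀ * Real.exp (L * t₁) := by fun_prop
    have hlim : Tendsto (fun L : ℝ => M₀ * Real.exp (L * t₁)) (𝓝[>] K)
        (𝓝 (M₀ * Real.exp (K * t₁))) :=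
      (hcont.tendsto K).mono_left nhdsWithin_le_nhds
    refine ge_of_tendsto hlim ?_
    filter_upwards [self_mem_nhdsWithin] with L hL'
    exact hL L hL' t₁ ⟨ht₁.1, le_rfl⟩ x
  intro L hKL
  by_contra hbad
  push Not at hbad
  obtain ⟨t', ht', x', hx'⟩ := hbad
  have hIcc : Icc 0 t₁ ⊆ Ico 0 T := fun s hs => ⟨hs.1, hs.2.trans_lt ht₁.2⟩
  set g : ℝ → T3 → ℝ := fun t x => ρ t x * Real.exp (-(L * t)) with hg
  have hg_le : ∀ {t : ℝ} {x z : T3}, ρ t x ≤ ρ t z → g t x ≤ g t z := fun h =>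
    mul_le_mul_of_nonneg_right h (Real.exp_pos _).le
  have hgt' : M₀ < g t' x' := by
    have hexp : 0 < Real.exp (L * t') := Real.exp_pos _
    show M₀ < ρ t' x' * Real.exp (-(L * t'))
    rw [Real.exp_neg, ← div_eq_mul_inv, lt_div_iff₀ hexp]
    exact hx'
  set c := g t' x' with hc
  set A : Set ℝ := {t | t ∈ Icc 0 t₁ ∧ ∃ x, c ≤ g t x} with hA
  have ht'A : t' ∈ A := ⟨ht', x', le_rfl⟩
  have hAne : A.Nonempty := ⟨t', ht'A⟩
  have hAbdd : BddBelow A := ⟨0, fun t ht => ht.1.1⟩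
  have h0A : (0 : ℝ) ∉ A := by
    rintro ⟨-, x, hx⟩
    have : g 0 x ≤ M₀ := by
      show ρ 0 x * Real.exp (-(L * 0)) ≤ M₀
      rw [mul_zero, neg_zero, Real.exp_zero, mul_one]; exact hyle x
    linarith
  have hAclosed : IsClosed A := by
    set Q : Set (EuclideanSpace ℝ (Fin 3)) :=
      (WithLp.toLp 2) '' (Set.pi univ fun _ : Fin 3 => Icc (0 : ℝ) 1) with hQ
    have hQc : IsCompact Q := Torus.isCompact_toLp_image_pi_Icc
    set G : ℝ × EuclideanSpace ℝ (Fin 3) → ℝ := fun p => Torus.stLift ρ p * Real.exp (-(L * p.1))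
      with hG
    have hGc : ContinuousOn G (Icc 0 t₁ ×ˢ Q) := by
      have h1 : ContinuousOn (Torus.stLift ρ) (Icc 0 t₁ ×ˢ Q) :=
        hE.smooth_density.continuousOn_stLift.mono (prod_mono hIcc (subset_univ _))
      have h2 : Continuous fun p : ℝ × EuclideanSpace ℝ (Fin 3) => Real.exp (-(L * p.1)) := by
        fun_prop
      exact h1.mul h2.continuousOn
    have hSclosed : IsClosed ((Icc 0 t₁ ×ˢ Q) ∩ G ⁻¹' Ici c) :=
      hGc.preimage_isClosed_of_isClosed (isClosed_Icc.prod hQc.isClosed) isClosed_Ici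
    have hSc : IsCompact ((Icc 0 t₁ ×ˢ Q) ∩ G ⁻¹' Ici c) :=
      (isCompact_Icc.prod hQc).of_isClosed_subset hSclosed inter_subset_left
    have hAeq : A = Prod.fst '' ((Icc 0 t₁ ×ˢ Q) ∩ G ⁻¹' Ici c) := by
      ext t
      constructor
      · rintro ⟨ht, x, hx⟩
        refine ⟨(t, Torus.repr x), ⟨mk_mem_prod ht (Torus.repr_mem_toLp_image_pi_Icc x), ?_⟩, rfl⟩
        show c ≤ Torus.stLift ρ (t, Torus.repr x) * Real.exp (-(L * t))
        simpa [Torus.stLift_apply, Torus.proj_repr] using hx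
      · rintro ⟨⟨s, y'⟩, ⟨hsy, hGy⟩, rfl⟩
        refine ⟨(mem_prod.1 hsy).1, Torus.proj y', ?_⟩
        have : c ≤ Torus.stLift ρ (s, y') * Real.exp (-(L * s)) := hGy
        simpa [Torus.stLift_apply] using this
    rw [hAeq]
    exact (hSc.image continuous_fst).isClosed
  set ts := sInf A with hts
  have htsA : ts ∈ A := hAclosed.csInf_mem hAne hAbdd
  obtain ⟨htsI, x₀, hx₀⟩ := htsA
  have hts0 : 0 < ts := lt_of_le_of_ne htsI.1 fun h => h0A (h ▸ ⟨htsI, x₀, hx₀⟩)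
  have htsT : ts ∈ Ico 0 T := hIcc htsI
  have hcts : Continuous (ρ ts) := (hE.smooth_density.isSmooth_slice htsT).continuous
  obtain ⟨xs, -, hxs⟩ := isCompact_univ.exists_isMaxOn univ_nonempty hcts.continuousOn
  have hcxs : c ≤ g ts xs := hx₀.trans (hg_le (hxs (mem_univ x₀)))
  have hbefore : ∀ s ∈ Ico 0 ts, g s xs < c := by
    intro s hs
    have hsA : s ∉ A := notMem_of_lt_csInf hs.2 hAbdd
    by_contra hle
    exact hsA ⟨⟨hs.1, hs.2.le.trans htsI.2⟩, xs, not_lt.1 hle⟩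
  set D := Torus.timeDerivWithin (Ico 0 T) ρ ts xs with hD
  have hslice : HasDerivAt (fun s => ρ s xs) D ts :=
    (hE.smooth_density.hasDerivWithinAt_slice htsT xs).hasDerivAt (Ico_mem_nhds hts0 htsT.2)
  have hexpd : HasDerivAt (fun s => Real.exp (-(L * s))) (Real.exp (-(L * ts)) * (-(L * 1))) ts :=
    (((hasDerivAt_id ts).const_mul L).neg).exp
  have hφ : HasDerivAt (fun s => g s xs)
      (D * Real.exp (-(L * ts)) + ρ ts xs * (Real.exp (-(L * ts)) * (-(L * 1)))) ts :=
    hslice.mul hexpd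
  have hφ' : 0 ≤ D * Real.exp (-(L * ts)) + ρ ts xs * (Real.exp (-(L * ts)) * (-(L * 1))) := by
    refine deriv_nonneg_of_left_max hφ ?_
    filter_upwards [Ico_mem_nhdsLT hts0] with s hs
    exact ((hbefore s hs).trans_le hcxs).le
  have hexp0 : 0 < Real.exp (-(L * ts)) := Real.exp_pos _
  have hDge : L * ρ ts xs ≤ D := by
    have : 0 ≤ Real.exp (-(L * ts)) * (D - L * ρ ts xs) := by
      have e : D * Real.exp (-(L * ts)) + ρ ts xs * (Real.exp (-(L * ts)) * (-(L * 1))) =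
          Real.exp (-(L * ts)) * (D - L * ρ ts xs) := by ring
      rwa [e] at hφ'
    nlinarith
  have hmass := hE.mass ts htsT xs
  have hdiv : Torus.divergence (fun z => ρ ts z • u ts z) xs = ρ ts xs * Torus.divergence (u ts) xs :=
    divergence_smul_of_isMaxOn (hE.smooth_density.isSmooth_slice htsT)
      (hE.smooth_velocity.isSmooth_slice htsT) hxs
  have hDle : D ≤ K * ρ ts xs := by
    have hK' := hK ts htsI xs
    have hρ := hE.density_pos ts htsT xs
    have : D = -(ρ ts xs * Torus.divergence (u ts) xs) := by rw [← hdiv]; linarith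
    rw [this]; nlinarith
  have hρpos := hE.density_pos ts htsT xs
  nlinarith

/-- `|div v(x)| ≤ 3 ‖Dv(x)‖` for a `C¹` vector field on `𝕋³` (`div = trace D`, orthonormal basis). [folklore] -/
theorem abs_divergence_le {v : T3 → V3} (hv : Torus.IsContDiff 1 v) (x : T3) :
    |Torus.divergence v x| ≤ 3 * ‖Torus.fderiv v x‖ := by
  rw [Torus.divergence_eq_trace_fderiv hv,
    LinearMap.trace_eq_sum_inner _ (EuclideanSpace.basisFun (Fin 3) ℝ)]
  set Lv := Torus.fderiv v x with hLv
  have hterm : ∀ i : Fin 3, |⟪(EuclideanSpace.basisFun (Fin 3) ℝ) i,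
      (Lv : V3 →ₗ[ℝ] V3) ((EuclideanSpace.basisFun (Fin 3) ℝ) i)⟫_ℝ| ≤ ‖Lv‖ := by
    intro i
    have hn : ‖(EuclideanSpace.basisFun (Fin 3) ℝ) i‖ = 1 := (EuclideanSpace.basisFun (Fin 3) ℝ).norm_eq_one i
    refine (abs_real_inner_le_norm _ _).trans ?_
    rw [hn, one_mul, ContinuousLinearMap.coe_coe]
    calc ‖Lv ((EuclideanSpace.basisFun (Fin 3) ℝ) i)‖ ≤ ‖Lv‖ * ‖(EuclideanSpace.basisFun (Fin 3) ℝ) i‖ :=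
          Lv.le_opNorm _
      _ = ‖Lv‖ := by rw [hn, mul_one]
  calc |∑ i, ⟪(EuclideanSpace.basisFun (Fin 3) ℝ) i, (Lv : V3 →ₗ[ℝ] V3) ((EuclideanSpace.basisFun (Fin 3) ℝ) i)⟫_ℝ|
      ≤ ∑ i, |⟪(EuclideanSpace.basisFun (Fin 3) ℝ) i, (Lv : V3 →ₗ[ℝ] V3) ((EuclideanSpace.basisFun (Fin 3) ℝ) i)⟫_ℝ| :=
        Finset.abs_sum_le_sum_abs _ _
    _ ≤ ∑ _i : Fin 3, ‖Lv‖ := Finset.sum_le_sum fun i _ => hterm i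
    _ = 3 * ‖Lv‖ := by simp

end DenseExcursionCompressionBudget

open DenseExcursionCompressionBudget DenseExcursionAtTimeZero in
/-- NO EXCURSION ON A BOUNDED COMPRESSION BUDGET (unconditional, EOS-free): with `-K ≤ div u` up to the excursion time
`t ≤ T₀`, `K, T₀` independent of `σ`, the packing of an admissible classical solution is `< (2e+1) M σ³ e^{|K| T₀} → 0`
(data pinning `ρ(0) = rhoLim < (2e+1)M`, Alexander for a flow family to test through, and the maximum principle).
[folklore] -/
theorem denseExcursion_false_boundedCompression : ¬ DenseExcursionBoundedCompression := by
  rintro ⟨K, T₀, η, hη, a₀, θ₀, u₀, ha, hθ, hu, ha0, hθ0, H⟩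
  obtain ⟨σ₁, hσ₁, hσ₁2, G⟩ := density_zero_eq_rhoLim ha hθ hu ha0 hθ0
  set P := profileOf a₀ ha ha0 with hP
  set B := (2 * Real.exp 1 + 1) * P.M * Real.exp (|K| * T₀) with hB
  have hB0 : 0 < B := by have := P.M_pos; positivity
  obtain ⟨σ, hσ, hσlt, T, ρ, θ, u, hE, hA, t, ht, htT₀, hK, x, hx⟩ :=
    H (min σ₁ (min 1 (η / B))) (lt_min hσ₁ (lt_min one_pos (div_pos hη hB0)))
  have hσ1 : σ < σ₁ := lt_of_lt_of_le hσlt (min_le_left _ _)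
  have hσone : σ < 1 := lt_of_lt_of_le hσlt ((min_le_right _ _).trans (min_le_left _ _))
  have hσB : σ < η / B := lt_of_lt_of_le hσlt ((min_le_right _ _).trans (min_le_right _ _))
  have hσ2 : σ < 1 / 2 := hσ1.trans_le hσ₁2
  obtain ⟨hS, G'⟩ := G σ hσ hσ1
  obtain ⟨Φ⟩ : Nonempty ((N : ℕ) → HardSphereFlow (Torus.geometry (Fin 3)) (hsDiameter σ N) (N + 1)) :=
    ⟨fun N => Classical.choice (HardSphereFlow.nonempty_torus_holds (d := Fin 3)
      (hsDiameter_pos hσ N) ((hsDiameter_le hσ.le N).trans_lt (hσ2.trans_eq (by norm_num))) (N + 1))⟩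
  have hT : 0 < T := ht.1.trans_lt ht.2
  have h0 : (0 : ℝ) ∈ Ico 0 T := ⟨le_rfl, hT⟩
  have hρ0 : ρ 0 = rhoLim P σ :=
    G' ρ θ u Φ (hE.smooth_density.isSmooth_slice h0).continuous (hA Φ)
  -- maximum principle + pinned data
  obtain ⟨y, hy⟩ := density_le_max_mul_exp hE ht hK
  have hlt0 : ρ 0 y < (2 * Real.exp 1 + 1) * P.M := by rw [hρ0]; exact rhoLim_lt hS y
  have hKt : K * t ≤ |K| * T₀ :=
    (mul_le_mul_of_nonneg_right (le_abs_self K) ht.1).trans (mul_le_mul_of_nonneg_left htT₀ (abs_nonneg K))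
  have hρB : ρ t x < B := by
    have hexp : 0 < Real.exp (K * t) := Real.exp_pos _
    have := P.M_pos
    calc ρ t x ≤ ρ 0 y * Real.exp (K * t) := hy x
      _ < (2 * Real.exp 1 + 1) * P.M * Real.exp (K * t) := by gcongr
      _ ≤ B := by rw [hB]; gcongr
  have hσ3 : σ ^ 3 ≤ σ := by
    have e : σ ^ 3 = σ * (σ * σ) := by ring
    rw [e]; exact mul_le_of_le_one_right hσ.le (by nlinarith)
  have hρpos : 0 < ρ t x := hE.density_pos t ht x
  have : ρ t x * σ ^ 3 < η :=
    calc ρ t x * σ ^ 3 ≤ ρ t x * σ := by gcongr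
      _ < B * (η / B) := mul_lt_mul'' hρB hσB hρpos.le hσ.le
      _ = η := mul_div_cancel₀ η hB0.ne'
  exact absurd hx (not_le.2 this)

open DenseExcursionCompressionBudget in
/-- NO EXCURSION INSIDE A `σ`-UNIFORM `C¹` REGIME OF THE VELOCITY (unconditional): `‖Du‖ ≤ M` gives `-3M ≤ div u`,
and `denseExcursion_false_boundedCompression` applies. [folklore] -/
theorem denseExcursion_false_lipschitzVelocity : ¬ DenseExcursionLipschitzVelocity := by
  rintro ⟨M, T₀, η, hη, a₀, θ₀, u₀, ha, hθ, hu, ha0, hθ0, H⟩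
  refine denseExcursion_false_boundedCompression ⟨3 * M, T₀, η, hη, a₀, θ₀, u₀, ha, hθ, hu, ha0, hθ0,
    fun σ₀ hσ₀ => ?_⟩
  obtain ⟨σ, hσ, hσlt, T, ρ, θ, u, hE, hA, t, ht, htT₀, hM, x, hx⟩ := H σ₀ hσ₀
  refine ⟨σ, hσ, hσlt, T, ρ, θ, u, hE, hA, t, ht, htT₀, fun s hs z => ?_, x, hx⟩
  have hsT : s ∈ Ico 0 T := ⟨hs.1, hs.2.trans_lt ht.2⟩
  have h1 : Torus.IsContDiff 1 (u s) := (hE.smooth_velocity.isSmooth_slice hsT).isContDiff (by simp)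
  have h := abs_divergence_le h1 z
  have h' := hM s hs z
  have := neg_abs_le (Torus.divergence (u s) z)
  linarith

end Summit.AtomisticToContinuum.HydrodynamicLimit.Theorems

end
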